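import Literature.NumberTheory.LFunctions.KMVMollifierDiagonalMainTerm

/-!
# Route `PrimeLevelFamEdge`, crux K_B `BeyondDiagonalBeatsQuarter` (stmt-Parity-20055), line `birth`
# (skeleton rev 2): registered stub D `stub_mollifierMainTermXSq` — LANDED

The rev-2 skeleton of `Cruxes/BeyondDiagonalBeatsQuarter/Lines/birth.lean` (lead ls-Bfam-prover-1 g0,
registered 2026-08-27T09:22:55Z) proves the old stub S1 (`T₁ Δ' (X²) 1 = 0` for `1 < Δ' < min Δ 2`)
from two declared stubs: F = Bettin's printed twisted first moment at prime level
(`bettin2017_theorem11_primeLevel`, fact debt) and D = the main-term evaluation of the DIAGONAL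
Möbius–ψ sum of the first mollified moment for the profile `X²`,
`KMV2000.MollifierMainTermAsymp (X ^ 2)`:
`Σ_{m ≤ M} μ(m)/(m ψ(m)) · (log(M/m)/log M)² = 2ζ(2)/log M + O(log⁻² M)`
(Kowalski–Michel–VanderKam 2000, §4.1 (19)–(20) at `k = 0`).

D is now a THEOREM of the tree: `KMV2000.mollifierMainTermAsymp_of_admissible`
(`Literature/NumberTheory/LFunctions/KMVMollifierDiagonalMainTerm.lean`, ls-Bfam-typer-1 g3, p519134 —
the prime number theorem for `μ` with the de la Vallée-Poussin remainder, the multiplicative weight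
`ψ(m)⁻¹` removed by the convergent convolution `μ/ψ·id⁻¹ = (μ·id⁻¹) ∗ h`, `Σ h = ζ(2)`), applied to
the admissible profile `X²` (`KMV2000.admissible_X_sq`). This file is the Theorems-side filing of the
registered stub BY NAME AND SIGNATURE, so that the crux item's stub census shows D closed; after it
lands the skeleton's only open stubs are F (printed fact; to become the route support item
`FirstMomentPrinted`) and S2 (`stub_secondCorrectionBelowSlackSomewhere`, XL, open in print).
No Theses statement is asserted. Standard axioms only.
«The programme SEARCHES and TYPES; no claim about Landau–Siegel zeros, Theorems 1–2 of
arXiv:2211.02515 or a repaired Margin232 until a kernel theorem says so.»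
-/

namespace Summit.Parity.GeneralizedHardyLittlewood.Theses.PrimeLevelFamEdge

open Polynomial
open Literature.NumberTheory.LFunctions

/-- **Stub D of the K_B line `birth` (rev 2), landed:** the diagonal Möbius–ψ sum of the first
mollified moment for the profile `X²` has the main term `ζ(2)·P′(1)/log M = 2ζ(2)/log M` with error
`O(log⁻² M)` — `KMV2000.mollifierMainTermAsymp_of_admissible` at `P = X²`.
[cite: KowalskiMichelVanderKam2000, §4.1 (19)–(20), Prop. 4.1 (case k = 0)] -/
theorem stub_mollifierMainTermXSq : KMV2000.MollifierMainTermAsymp (X ^ 2) :=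
  KMV2000.mollifierMainTermAsymp_of_admissible KMV2000.admissible_X_sq

end Summit.Parity.GeneralizedHardyLittlewood.Theses.PrimeLevelFamEdge

/-! ## Appended 2026-08-27 (ls-Bfam-prover-1 g2): the same diagonal main term for EVERY admissible
profile, and the census re-link of stub D to the restated crux item

Route rev 3 (commit 2437b0f57bb2) restated K_B as `FirstMomentPrinted → C′` under the NEW item id
stmt-Parity-20343 (20055 superseded); the registered skeleton (rev 4/5 of `Lines/birth.lean`) keeps the
stub `stub_mollifierMainTermXSq` verbatim (name and signature as landed above, p520179, credited on
20055). This append carries the file — and with it the unchanged stub theorem above — to the restated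
item's census (`--supports stmt-Parity-20343`), and records the profile-uniform form the K_A-side
consolidation at `Q = 1` uses (`KMV2000.firstDisplay_of_bettin'`, `…firstCorrectionVanishes_of_bettin'`).
-/

namespace Summit.Parity.GeneralizedHardyLittlewood.Theses.PrimeLevelFamEdge

open Polynomial
open Literature.NumberTheory.LFunctions

/-- The diagonal Möbius–ψ main term of the first mollified moment for EVERY admissible profile `P`
(`P(0) = P′(0) = 0`): `Σ_{m ≤ M} μ(m)/(mψ(m))·P(log(M/m)/log M) = ζ(2)P′(1)/log M + O_P(log⁻² M)` —
`KMV2000.mollifierMainTermAsymp_of_admissible` (p519134) in the quantifier shape consumed by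
`KMV2000.firstCorrectionVanishes_of_bettin'`; stub D above is its instance `P = X²`.
[cite: KowalskiMichelVanderKam2000, §4.1 (19)–(20), Prop. 4.1 (case k = 0)] -/
theorem mollifierMainTerm_allProfiles :
    ∀ P : ℝ[X], KMV2000.Admissible P → KMV2000.MollifierMainTermAsymp P :=
  fun _ hP ↦ KMV2000.mollifierMainTermAsymp_of_admissible hP

/-- Instance at the Kowalski–Michel–VanderKam record profile `P₁ = X² − X³/6` (`KMV2000.kmvP1`, the
`7/16` profile of `KMV2000.ratio_one_kmvP1`). [cite: KowalskiMichelVanderKam2000, §4.1 (19)–(20) and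
p. 2 (p₁ ≥ 7/16)] -/
theorem mollifierMainTerm_kmvP1 : KMV2000.MollifierMainTermAsymp KMV2000.kmvP1 :=
  KMV2000.mollifierMainTermAsymp_of_admissible KMV2000.admissible_kmvP1

end Summit.Parity.GeneralizedHardyLittlewood.Theses.PrimeLevelFamEdge
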